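import Summits.ABC.StewartYu.PadicG3TwoSlabFunctions
import Summits.ABC.StewartYu.SiegelOnFinset
import Mathlib.NumberTheory.Padics.RingHoms
import HarnessLib

/-!
# Cell abc-stewartyu, Gen-3 frame at `p = 2` (crux `Y07Two`, stmt-ABC-19659), layer F3-SLAB: the `2`-adic SLAB
# CLASS of the unknown family by ONE pigeonhole (design of record D-F2; twin of p2-g4's `PadicG3Slab` at `p = 2`,
# where the twist class `μ_{p−1}` is trivial)

`Summits/ABC/StewartYu/PadicG3TwoSlabClass.lean` — cell `abc-stewartyu` (HOME `run/shared/lean/pub/abc-stewartyu/`),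
route `PadicPrimesKummerThird`, seat p3 (g5), F-two LEAD.  Definitions and theorems on `TwoSetup`, for the
generic unknown family `(u, u_θ) : ι → ℤᵈ × ℤ` of `PadicG3TwoFunctions`.

Every exact exponent `zψ(i) = ∑ uᵢⱼ lg j + u_θᵢ lgθ` lies in `8ℤ₂` (`‖zψ‖ ≤ 8⁻¹`); its class
`slabCls m i := 8⁻¹·zψ(i) mod 2^m ∈ ℤ/2^m` takes at most `2^m` values, so (`SiegelFinset.exists_class_card_ge`)
every finite `B` contains a class `𝔏 = B.filter (slabCls m · = c)` with `#B ≤ 2^m·#𝔏`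
(`exists_slabTwo_class`), on which `‖zψ(i) − zψ(i′)‖ ≤ 2^{−(m+3)}` (`norm_zψ_sub_le_of_slabCls_eq`).  Under the
negated bound `‖Λ₀‖ ≤ 2^{−(m+3)}` the `b`-ELIMINATED differences obey the same bound:
`‖δexpo i₀ i‖ ≤ 2^{−(m+3)}` (`norm_δexpo_le_of_slab`) — exactly the hypothesis `hslab` of
`PadicG3TwoSlabFunctions` / `…SlabSeries` / `…SlabKStep`.  With `exists_g3_siegel` on `B := 𝔏` this is the
slab Siegel step (the count loses the factor `2^m ≤ e^{c·n}`, `m ≈ 8(n+1)/log 2` — the record's line).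

WHAT THIS IS NOT: no choice of `m` (record); no crux moves.

References: K. Yu, Acta Arith. 89 (1999), p. 340, §10 (10.13)–(10.19); K. Yu, Acta Math. 211 (2013), (4.19).
-/

noncomputable section

open Finset NormedSpace IsUltrametricDist
open Literature.NumberTheory.Transcendental

namespace Summit.ABC.StewartYu

namespace TwoSetup

variable (S : TwoSetup) {ι : Type*} (u : ι → Fin S.d → ℤ) (uθ : ι → ℤ)

/-! ### The slab class `8⁻¹·zψ mod 2^m` -/

/-- `‖8⁻¹ · zψ(i)‖ ≤ 1`. [folklore] -/
theorem norm_inv_eight_mul_zψ_le (i : ι) : ‖((8 : ℚ_[2]))⁻¹ * S.zψ (u i) (uθ i)‖ ≤ 1 := by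
  have h8 : ‖(8 : ℚ_[2])‖ = (8 : ℝ)⁻¹ := by
    have : (8 : ℚ_[2]) = ((2 : ℕ) : ℚ_[2]) ^ 3 := by norm_num
    rw [this, norm_pow, Padic.norm_p]; norm_num
  rw [norm_mul, norm_inv, h8, inv_inv]
  calc (8 : ℝ) * ‖S.zψ (u i) (uθ i)‖ ≤ 8 * (8 : ℝ)⁻¹ :=
        mul_le_mul_of_nonneg_left (S.norm_zψ_le _ _) (by norm_num)
    _ = 1 := by norm_num

/-- The `2`-adic integer `8⁻¹·zψ(i)`. [cite: Yu1999, §10 (10.14)] -/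
def slabIntTwo (i : ι) : ℤ_[2] := ⟨((8 : ℚ_[2]))⁻¹ * S.zψ (u i) (uθ i), S.norm_inv_eight_mul_zψ_le u uθ i⟩

/-- **The slab class** `8⁻¹·zψ(i) mod 2^m ∈ ℤ/2^m`. [cite: Yu1999, p. 340, §10 (10.14)] -/
def slabClsTwo (m : ℕ) (i : ι) : ZMod (2 ^ m) := PadicInt.toZModPow m (S.slabIntTwo u uθ i)

/-- **Equal slab classes ⇒ the exact exponents are congruent mod `2^{m+3}`**:
`‖zψ(i) − zψ(i′)‖ ≤ 2^{−(m+3)}`. [cite: Yu1999, §10 (10.15)] -/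
theorem norm_zψ_sub_le_of_slabCls_eq (m : ℕ) {i i' : ι}
    (h : S.slabClsTwo u uθ m i = S.slabClsTwo u uθ m i') :
    ‖S.zψ (u i) (uθ i) - S.zψ (u i') (uθ i')‖ ≤ ((2 : ℝ) ^ (m + 3))⁻¹ := by
  have hker : S.slabIntTwo u uθ i - S.slabIntTwo u uθ i' ∈
      RingHom.ker (PadicInt.toZModPow m : ℤ_[2] →+* ZMod (2 ^ m)) := by
    rw [RingHom.mem_ker, map_sub, sub_eq_zero]
    exact h
  rw [PadicInt.ker_toZModPow, ← PadicInt.norm_le_pow_iff_mem_span_pow] at hker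
  have hnorm : ‖(((8 : ℚ_[2]))⁻¹ * S.zψ (u i) (uθ i) - ((8 : ℚ_[2]))⁻¹ * S.zψ (u i') (uθ i'))‖ ≤
      ((2 : ℕ) : ℝ) ^ (-(m : ℤ)) := by
    have : ‖S.slabIntTwo u uθ i - S.slabIntTwo u uθ i'‖ =
        ‖(((8 : ℚ_[2]))⁻¹ * S.zψ (u i) (uθ i) - ((8 : ℚ_[2]))⁻¹ * S.zψ (u i') (uθ i'))‖ := rfl
    rw [← this]; exact hker
  have h8ne : (8 : ℚ_[2]) ≠ 0 := by norm_num
  have h8 : ‖(8 : ℚ_[2])‖ = (8 : ℝ)⁻¹ := by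
    have : (8 : ℚ_[2]) = ((2 : ℕ) : ℚ_[2]) ^ 3 := by norm_num
    rw [this, norm_pow, Padic.norm_p]; norm_num
  have key : S.zψ (u i) (uθ i) - S.zψ (u i') (uθ i') =
      (8 : ℚ_[2]) * (((8 : ℚ_[2]))⁻¹ * S.zψ (u i) (uθ i) - ((8 : ℚ_[2]))⁻¹ * S.zψ (u i') (uθ i')) := by
    rw [mul_sub, ← mul_assoc, mul_inv_cancel₀ h8ne, one_mul, ← mul_assoc, mul_inv_cancel₀ h8ne, one_mul]
  rw [key, norm_mul, h8]
  calc (8 : ℝ)⁻¹ * ‖((8 : ℚ_[2]))⁻¹ * S.zψ (u i) (uθ i) - ((8 : ℚ_[2]))⁻¹ * S.zψ (u i') (uθ i')‖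
      ≤ (8 : ℝ)⁻¹ * ((2 : ℕ) : ℝ) ^ (-(m : ℤ)) := mul_le_mul_of_nonneg_left hnorm (by norm_num)
    _ = ((2 : ℝ) ^ (m + 3))⁻¹ := by
        rw [zpow_neg, zpow_natCast, pow_add]; push_cast; field_simp; norm_num

/-! ### The pigeonhole -/

/-- **THE `2`-ADIC SLAB BY PIGEONHOLE**: every finite set `B` of unknowns contains a class `𝔏 ⊆ B` of one value
of `slabClsTwo m` with `#B ≤ 2^m·#𝔏`; on it the exact exponents are congruent mod `2^{m+3}`.
[cite: Yu1999, p. 340, §10 (10.14)] [cite: Yu2013, (4.19)] -/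
theorem exists_slabTwo_class (m : ℕ) (B : Finset ι) :
    ∃ 𝔏 : Finset ι, 𝔏 ⊆ B ∧ B.card ≤ 2 ^ m * 𝔏.card ∧
      ∀ i ∈ 𝔏, ∀ i' ∈ 𝔏, ‖S.zψ (u i) (uθ i) - S.zψ (u i') (uθ i')‖ ≤ ((2 : ℝ) ^ (m + 3))⁻¹ := by
  classical
  haveI : NeZero (2 ^ m) := ⟨pow_ne_zero _ two_ne_zero⟩
  have hcard : Fintype.card (ZMod (2 ^ m)) ≤ 2 ^ m := by rw [ZMod.card]
  obtain ⟨c, hc⟩ := SiegelFinset.exists_class_card_ge B (fun i => S.slabClsTwo u uθ m i) hcard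
  refine ⟨B.filter fun i => S.slabClsTwo u uθ m i = c, filter_subset _ _, hc, ?_⟩
  intro i hi i' hi'
  have h1 := (mem_filter.mp hi).2
  have h2 := (mem_filter.mp hi').2
  exact S.norm_zψ_sub_le_of_slabCls_eq u uθ m (by rw [h1, h2])

/-! ### The `b`-eliminated differences on the slab -/

/-- **On a slab class, under the negated bound, the hypothesis `hslab` of the slab family holds**: if
`‖zψ(i) − zψ(i₀)‖ ≤ 2^{−(m+3)}` on `𝔏` and `‖Λ₀‖ ≤ 2^{−(m+3)}`, then `‖δexpo i₀ i‖ ≤ 2^{−(m+3)}` on `𝔏`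
(`δexpo = (zψ(i) − zψ(i₀)) + (u_θᵢ − u_θ_{i₀})·Λ₀`). [cite: Yu2013, (4.11); shape only] -/
theorem norm_δexpo_le_of_slab (𝔏 : Finset ι) (i₀ : ι) (hi₀ : i₀ ∈ 𝔏) {m : ℕ}
    (h𝔏 : ∀ i ∈ 𝔏, ∀ i' ∈ 𝔏, ‖S.zψ (u i) (uθ i) - S.zψ (u i') (uθ i')‖ ≤ ((2 : ℝ) ^ (m + 3))⁻¹)
    (hΛ : ‖S.Λ₀‖ ≤ ((2 : ℝ) ^ (m + 3))⁻¹) :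
    ∀ i ∈ 𝔏, ‖S.δexpo u uθ i₀ i‖ ≤ ((2 : ℝ) ^ (m + 3))⁻¹ := by
  intro i hi
  have e : S.δexpo u uθ i₀ i =
      (S.zψ (u i) (uθ i) - S.zψ (u i₀) (uθ i₀)) + ((uθ i : ℚ_[2]) - (uθ i₀ : ℚ_[2])) * S.Λ₀ := by
    unfold δexpo
    rw [S.zexpo_eq, S.zexpo_eq]
    ring
  rw [e]
  refine (norm_add_le_max _ _).trans (max_le (h𝔏 i hi i₀ hi₀) ?_)
  rw [norm_mul]
  refine (mul_le_of_le_one_left (norm_nonneg _) ?_).trans hΛ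
  have : ((uθ i : ℚ_[2]) - (uθ i₀ : ℚ_[2])) = ((uθ i - uθ i₀ : ℤ) : ℚ_[2]) := by push_cast; ring
  rw [this]
  exact Padic.norm_int_le_one _

/-- **The slab of the frame, packaged**: for every finite unknown set `B` and depth `m`, under
`‖Λ₀‖ ≤ 2^{−(m+3)}`, there is `𝔏 ⊆ B` with `#B ≤ 2^m·#𝔏` such that for EVERY base point `i₀ ∈ 𝔏` the slab
hypothesis `∀ i ∈ 𝔏, ‖δexpo i₀ i‖ ≤ 2^{−(m+3)}` holds. [cite: Yu1999, p. 340] -/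
theorem exists_slabTwo (m : ℕ) (B : Finset ι) (hΛ : ‖S.Λ₀‖ ≤ ((2 : ℝ) ^ (m + 3))⁻¹) :
    ∃ 𝔏 : Finset ι, 𝔏 ⊆ B ∧ B.card ≤ 2 ^ m * 𝔏.card ∧
      ∀ i₀ ∈ 𝔏, ∀ i ∈ 𝔏, ‖S.δexpo u uθ i₀ i‖ ≤ ((2 : ℝ) ^ (m + 3))⁻¹ := by
  obtain ⟨𝔏, hsub, hcard, h𝔏⟩ := S.exists_slabTwo_class u uθ m B
  exact ⟨𝔏, hsub, hcard, fun i₀ hi₀ => S.norm_δexpo_le_of_slab u uθ 𝔏 i₀ hi₀ h𝔏 hΛ⟩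

end TwoSetup

end Summit.ABC.StewartYu

end
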